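import Summits.ResolutionOfSingularities.ResolutionOfSingularities.Theorems.FrobeniusLadderFInjectiveMacaulayficationOfPointFixable
import Summits.ResolutionOfSingularities.ResolutionOfSingularities.Theorems.FrobeniusLadderFInjectiveMacaulayficationClauseOfMaximal
import Summits.ResolutionOfSingularities.ResolutionOfSingularities.Theorems.FrobeniusLadderFInjectiveMacaulayficationFiLocusOpenOfAffine
import Summits.ResolutionOfSingularities.ResolutionOfSingularities.Theorems.FrobeniusLadderFInjectiveMacaulayficationDegreeZeroDescentLocal
import Mathlib.RingTheory.Jacobson.Ring
import HarnessLib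

/-!
# The specimen door: an F-injective Macaulayfication of `Spec k[X]/(Fs)` from point-fixability of the origin stalk
# (crux `FInjectiveMacaulayfication`, K-T4 Lean half, generic form)

Support file for crux stmt-ResolutionOfSingularities-15315 (`FrobeniusLadder.FInjectiveMacaulayfication`), chain w45a,
seat res-L1-w45a-stub-3 (res-L1-w45a-plan-1 RULING R12.24 (a): "cut `T11SpecimenDoor` as a GENERIC door"). [OURS · L1 W4.5a] —
produced inside this programme; reviewed only by AI agents (AI review is weaker than expert human review).

The setting is an affine `k`-variety `X = Spec R`, `R = k[X₀,…,X_{n-1}]/(Fs)` a domain (`Fs : Fin r → k[X]` generating a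
prime ideal), `char k = p`, with a distinguished closed point, the origin `𝔪 = (x̄₀, …, x̄_{n-1})` (a maximal ideal of
`R`, hypothesis `h𝔪` — e.g. `QuotientOriginMaximal.isMaximal_span_range_mk_X` when the `Fs` have no constant term).
The specimen-specific inputs are three binders:

* `hoff` — at every maximal ideal `Q` missing some variable `x̄_j` the local ring `R_Q` satisfies the per-stalk clause of
  the crux (every system of parameters is weakly regular and generates a Frobenius closed ideal);
* `hCM` — at every maximal ideal the local ring is Cohen–Macaulay (for complete intersections this is characteristic
  free);
* `h0` — the stalk of `X` at the origin is point-fixable in the sense of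
  `OfPointFixable.fInjectiveMacaulayfication_of_pointFixable` (a finite family `c` generating a nonzero ideal with
  radical the maximal ideal whose affine blow-up algebras satisfy the clause, as domains, over the closed point).

## The argument (`fInjectiveMacaulayfication_of_originPointFixable`)

`R` is a Jacobson ring, so a prime `P ≠ 𝔪` — which misses some `x̄_j` because `𝔪` is maximal — lies in a maximal
`Q ∌ x̄_j` (`exists_isMaximal_not_mem`); `R_Q` is a domain satisfying the clause (`hoff`), and the clause descends to
`R_P` (`ClauseOfMaximal.fiClause_atPrime_of_le`): §1 `fiClause_atPrime_of_exists_not_mem`. Hence every stalk of `X` is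
Cohen–Macaulay (`hCM` at the origin, §1 elsewhere), the non-F-injective locus is contained in `{𝔪}`, hence finite,
and `h0` is point-fixability there; `X → Spec k` is separated, quasi-compact (affine) and locally of finite type, and
`X` is integral; `OfPointFixable.fInjectiveMacaulayfication_of_pointFixable` (A-loc) assembles the proper birational
model. Stalks of `Spec R` are moved to `Localization.AtPrime` along `Spec.stalkIso`
(`DegreeZeroDescent.inlineClause_of_ringEquiv`, `FiLocusOpenOfAffine.cmClause_of_ringEquiv`).

Instances: `T11SpecimenDoor.fInjectiveMacaulayfication_T11plus_char7` (`T₁₁⁺`, `p = 7`; written out directly) and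
stub-4's `T4SpecimenDoor` (`T⁽⁴⁾⁺`, `p = 7`). [folklore assembly; the local algebra inputs are the binders]
No new definitions; no `sorry`; classical axioms only.
-/

namespace Summit.ResolutionOfSingularities.ResolutionOfSingularities.Theorems.FInjectiveMacaulayfication.SpecimenDoor

open AlgebraicGeometry CategoryTheory MvPolynomial IsLocalRing Literature.AlgebraicGeometry.Resolution
open Summit.ResolutionOfSingularities.ResolutionOfSingularities.Theorems.FInjectiveMacaulayfication

/-! ## §1 The clause off the origin from `hoff` at the closed points -/

/-- **Jacobson step**: in `R = k[X]/(Fs)` (a Jacobson ring) a prime `P` missing an element `t` lies in a maximal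
ideal missing `t`. [folklore] -/
theorem exists_isMaximal_not_mem {k : Type} [Field k] {n r : ℕ} (Fs : Fin r → MvPolynomial (Fin n) k)
    (P : Ideal (MvPolynomial (Fin n) k ⧸ Ideal.span (Set.range Fs))) [P.IsPrime] (t : (MvPolynomial (Fin n) k ⧸ Ideal.span (Set.range Fs))) (ht : t ∉ P) :
    ∃ Q : Ideal (MvPolynomial (Fin n) k ⧸ Ideal.span (Set.range Fs)), Q.IsMaximal ∧ P ≤ Q ∧ t ∉ Q := by
  by_contra hcon
  push Not at hcon
  apply ht
  have hJ : P.jacobson = P := IsJacobsonRing.out inferInstance (Ideal.IsPrime.isRadical ‹_›)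
  rw [← hJ, Ideal.jacobson, Ideal.mem_sInf]
  rintro Q ⟨hPQ, hQ⟩
  exact hcon Q hQ hPQ

/-- **§1 THE CLAUSE AT EVERY PRIME MISSING A VARIABLE, from the clause at the closed points missing a variable.**
`R = k[X]/(Fs)` a domain of characteristic `p`; if `R_Q` satisfies the per-stalk clause at every maximal `Q` missing
some `x̄_j` (`hoff`), then for every prime `P` missing some `x̄_j` the local ring `R_P` is a domain satisfying the
clause: `P ⊆ Q` maximal with `x̄_j ∉ Q` (Jacobson), `R_Q` is a domain (a localization of the domain `R`), and the
clause descends along `R_Q → R_P` (`ClauseOfMaximal.fiClause_atPrime_of_le`). [folklore] -/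
theorem fiClause_atPrime_of_exists_not_mem (p : ℕ) (hp : p.Prime) (k : Type) [Field k] [CharP k p] (n r : ℕ)
    (Fs : Fin r → MvPolynomial (Fin n) k) (hprime : (Ideal.span (Set.range Fs)).IsPrime)
    (hoff : ∀ (Q : Ideal (MvPolynomial (Fin n) k ⧸ Ideal.span (Set.range Fs))) [Q.IsMaximal],
      (∃ j : Fin n, Ideal.Quotient.mk (Ideal.span (Set.range Fs)) (X j) ∉ Q) →
      ∀ d : ℕ, ringKrullDim (Localization.AtPrime Q) = d → ∀ s : Fin d → Localization.AtPrime Q, (Ideal.span (Set.range s)).radical.IsMaximal →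
        RingTheory.Sequence.IsWeaklyRegular (Localization.AtPrime Q) (List.ofFn s) ∧
        ∀ y : Localization.AtPrime Q, (∃ e : ℕ, y ^ p ^ e ∈ Ideal.span ((fun z : Localization.AtPrime Q => z ^ p ^ e) ''
          (Ideal.span (Set.range s) : Set (Localization.AtPrime Q)))) → y ∈ Ideal.span (Set.range s))
    (P : Ideal (MvPolynomial (Fin n) k ⧸ Ideal.span (Set.range Fs))) [P.IsPrime] (hP : ∃ j : Fin n, Ideal.Quotient.mk (Ideal.span (Set.range Fs)) (X j) ∉ P) :
    IsDomain (Localization.AtPrime P) ∧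
      ∀ d : ℕ, ringKrullDim (Localization.AtPrime P) = d → ∀ s : Fin d → Localization.AtPrime P, (Ideal.span (Set.range s)).radical.IsMaximal →
        RingTheory.Sequence.IsWeaklyRegular (Localization.AtPrime P) (List.ofFn s) ∧
        ∀ y : Localization.AtPrime P, (∃ e : ℕ, y ^ p ^ e ∈ Ideal.span ((fun z : Localization.AtPrime P => z ^ p ^ e) ''
          (Ideal.span (Set.range s) : Set (Localization.AtPrime P)))) → y ∈ Ideal.span (Set.range s) := by
  haveI : Fact p.Prime := ⟨hp⟩
  haveI := hprime
  haveI : IsDomain (MvPolynomial (Fin n) k ⧸ Ideal.span (Set.range Fs)) := Ideal.Quotient.isDomain _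
  haveI : CharP (MvPolynomial (Fin n) k ⧸ Ideal.span (Set.range Fs)) p := charP_of_injective_algebraMap (algebraMap k (MvPolynomial (Fin n) k ⧸ Ideal.span (Set.range Fs))).injective p
  have hdom : ∀ (Q : Ideal (MvPolynomial (Fin n) k ⧸ Ideal.span (Set.range Fs))) [Q.IsPrime], IsDomain (Localization.AtPrime Q) := fun Q _ =>
    IsLocalization.isDomain_localization Q.primeCompl_le_nonZeroDivisors
  obtain ⟨j, hj⟩ := hP
  obtain ⟨Q, hQ, hPQ, hjQ⟩ := exists_isMaximal_not_mem Fs P _ hj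
  haveI := hQ
  exact ClauseOfMaximal.fiClause_atPrime_of_le p hPQ ⟨hdom Q, hoff Q ⟨j, hjQ⟩⟩

/-! ## §2 The door -/

/-- **THE SPECIMEN DOOR.** Let `R = k[X₀,…,X_{n-1}]/(Fs)` with `(Fs)` prime, `char k = p`, and let the origin
`𝔪 = (x̄₀, …, x̄_{n-1})` be a maximal ideal of `R`. Suppose: (`hoff`) at every maximal ideal missing some variable the
local ring satisfies the per-stalk clause of crux `FrobeniusLadder.FInjectiveMacaulayfication` (every system of
parameters is weakly regular and generates a Frobenius closed ideal); (`hCM`) at every maximal ideal the local ring is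
Cohen–Macaulay; (`h0`) the stalk of `X = Spec R` at the origin is point-fixable — a finite family `c` in `𝒪_{X,𝔪}`
generating a nonzero ideal with radical the maximal ideal such that every prime of every affine blow-up algebra
`𝒪_{X,𝔪}[(c)/c_j]` over the closed point has a local ring that is a domain satisfying the clause. Then `X` has an
F-injective Macaulayfication: a proper birational `π : X' → X` all of whose stalks are domains satisfying the clause.
Proof: `OfPointFixable.fInjectiveMacaulayfication_of_pointFixable` (A-loc) for `X → Spec k` (separated, quasi-compact,
locally of finite type; `X` integral), with every stalk Cohen–Macaulay (`hCM` at the origin, §1 elsewhere) and the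
non-F-injective locus inside `{𝔪}` by §1. [OURS · L1 W4.5a; folklore assembly] -/
theorem fInjectiveMacaulayfication_of_originPointFixable (p : ℕ) (hp : p.Prime) (k : Type) [Field k] [CharP k p]
    (n r : ℕ) (Fs : Fin r → MvPolynomial (Fin n) k) (hprime : (Ideal.span (Set.range Fs)).IsPrime)
    (h𝔪 : (Ideal.span (Set.range fun j : Fin n => Ideal.Quotient.mk (Ideal.span (Set.range Fs)) (X j))).IsMaximal)
    (hoff : ∀ (Q : Ideal (MvPolynomial (Fin n) k ⧸ Ideal.span (Set.range Fs))) [Q.IsMaximal],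
      (∃ j : Fin n, Ideal.Quotient.mk (Ideal.span (Set.range Fs)) (X j) ∉ Q) →
      ∀ d : ℕ, ringKrullDim (Localization.AtPrime Q) = d → ∀ s : Fin d → Localization.AtPrime Q, (Ideal.span (Set.range s)).radical.IsMaximal →
        RingTheory.Sequence.IsWeaklyRegular (Localization.AtPrime Q) (List.ofFn s) ∧
        ∀ y : Localization.AtPrime Q, (∃ e : ℕ, y ^ p ^ e ∈ Ideal.span ((fun z : Localization.AtPrime Q => z ^ p ^ e) ''
          (Ideal.span (Set.range s) : Set (Localization.AtPrime Q)))) → y ∈ Ideal.span (Set.range s))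
    (hCM : ∀ (Q : Ideal (MvPolynomial (Fin n) k ⧸ Ideal.span (Set.range Fs))) [Q.IsMaximal],
      ∀ d : ℕ, ringKrullDim (Localization.AtPrime Q) = d → ∀ s : Fin d → Localization.AtPrime Q, (Ideal.span (Set.range s)).radical.IsMaximal →
        RingTheory.Sequence.IsWeaklyRegular (Localization.AtPrime Q) (List.ofFn s))
    (h0 : ∀ b : Spec (.of (MvPolynomial (Fin n) k ⧸ Ideal.span (Set.range Fs))), b.asIdeal = Ideal.span (Set.range fun j : Fin n => Ideal.Quotient.mk (Ideal.span (Set.range Fs)) (X j)) →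
      ∃ (m : ℕ) (c : Fin m → (Spec (.of (MvPolynomial (Fin n) k ⧸ Ideal.span (Set.range Fs)))).presheaf.stalk b), Ideal.span (Set.range c) ≠ ⊥ ∧ (Ideal.span (Set.range c)).radical = IsLocalRing.maximalIdeal ((Spec (.of (MvPolynomial (Fin n) k ⧸ Ideal.span (Set.range Fs)))).presheaf.stalk b) ∧
        ∀ (j : Fin m) (𝔔 : PrimeSpectrum (Literature.AlgebraicGeometry.Resolution.blowupAlgebra (Ideal.span (Set.range c)) (c j))),
          𝔔.asIdeal.comap (algebraMap ((Spec (.of (MvPolynomial (Fin n) k ⧸ Ideal.span (Set.range Fs)))).presheaf.stalk b) (Literature.AlgebraicGeometry.Resolution.blowupAlgebra (Ideal.span (Set.range c)) (c j))) = IsLocalRing.maximalIdeal ((Spec (.of (MvPolynomial (Fin n) k ⧸ Ideal.span (Set.range Fs)))).presheaf.stalk b) →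
          IsDomain (Localization.AtPrime 𝔔.asIdeal) ∧ ∀ d : ℕ, ringKrullDim (Localization.AtPrime 𝔔.asIdeal) = d → ∀ s : Fin d → Localization.AtPrime 𝔔.asIdeal, (Ideal.span (Set.range s)).radical.IsMaximal → RingTheory.Sequence.IsWeaklyRegular (Localization.AtPrime 𝔔.asIdeal) (List.ofFn s) ∧ ∀ y : Localization.AtPrime 𝔔.asIdeal, (∃ e : ℕ, y ^ p ^ e ∈ Ideal.span ((fun z : Localization.AtPrime 𝔔.asIdeal => z ^ p ^ e) '' (Ideal.span (Set.range s) : Set (Localization.AtPrime 𝔔.asIdeal)))) → y ∈ Ideal.span (Set.range s)) :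
        ∃ (X' : Scheme.{0}) (π : X' ⟶ (Spec (.of (MvPolynomial (Fin n) k ⧸ Ideal.span (Set.range Fs))))), IsProper π ∧ Literature.AlgebraicGeometry.Resolution.IsBirational π ∧
      ∀ x : X', IsDomain (X'.presheaf.stalk x) ∧ ∀ d : ℕ, ringKrullDim (X'.presheaf.stalk x) = d → ∀ s : Fin d → X'.presheaf.stalk x, (Ideal.span (Set.range s)).radical.IsMaximal → RingTheory.Sequence.IsWeaklyRegular (X'.presheaf.stalk x) (List.ofFn s) ∧ ∀ y : X'.presheaf.stalk x, (∃ e : ℕ, y ^ p ^ e ∈ Ideal.span ((fun z : X'.presheaf.stalk x => z ^ p ^ e) '' (Ideal.span (Set.range s) : Set (X'.presheaf.stalk x)))) → y ∈ Ideal.span (Set.range s) := by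
  haveI := hprime
  haveI : IsDomain (MvPolynomial (Fin n) k ⧸ Ideal.span (Set.range Fs)) := Ideal.Quotient.isDomain _
  -- primes other than the origin miss a variable
  have hne : ∀ P : Ideal (MvPolynomial (Fin n) k ⧸ Ideal.span (Set.range Fs)), P.IsPrime → P ≠ Ideal.span (Set.range fun j : Fin n => Ideal.Quotient.mk (Ideal.span (Set.range Fs)) (X j)) →
      ∃ j : Fin n, Ideal.Quotient.mk (Ideal.span (Set.range Fs)) (X j) ∉ P := by
    intro P hP hPne
    by_contra hcon
    push Not at hcon
    apply hPne
    refine (h𝔪.eq_of_le hP.ne_top ?_).symm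
    rw [Ideal.span_le]
    rintro _ ⟨j, rfl⟩
    exact hcon j
  -- the structure morphism `Spec R → Spec k` and its admissibility
  let f₁ : Spec (.of (MvPolynomial (Fin n) k ⧸ Ideal.span (Set.range Fs))) ⟶ Spec (.of k) := Spec.map (CommRingCat.ofHom (algebraMap k (MvPolynomial (Fin n) k ⧸ Ideal.span (Set.range Fs))))
  have hft : LocallyOfFiniteType f₁ :=
    (HasRingHomProperty.Spec_iff (P := @LocallyOfFiniteType)).mpr (RingHom.finiteType_algebraMap.mpr inferInstance)
  have hsep : IsSeparated f₁ := inferInstance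
  have hqc : QuasiCompact f₁ := inferInstance
  have hint : IsIntegral (Spec (.of (MvPolynomial (Fin n) k ⧸ Ideal.span (Set.range Fs)))) := inferInstance
  -- stalks of `Spec R` are the localizations
  have e : ∀ x : Spec (.of (MvPolynomial (Fin n) k ⧸ Ideal.span (Set.range Fs))),
      (Spec (.of (MvPolynomial (Fin n) k ⧸ Ideal.span (Set.range Fs)))).presheaf.stalk x ≃+* Localization.AtPrime x.asIdeal :=
    fun x => (Spec.stalkIso (.of (MvPolynomial (Fin n) k ⧸ Ideal.span (Set.range Fs))) x).commRingCatIsoToRingEquiv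
  -- the clause on the stalks off the origin
  have hfull := fun (x : Spec (.of (MvPolynomial (Fin n) k ⧸ Ideal.span (Set.range Fs)))) (hx : x.asIdeal ≠ Ideal.span (Set.range fun j : Fin n => Ideal.Quotient.mk (Ideal.span (Set.range Fs)) (X j))) =>
    DegreeZeroDescent.inlineClause_of_ringEquiv (L := Localization.AtPrime x.asIdeal)
      (L' := (Spec (.of (MvPolynomial (Fin n) k ⧸ Ideal.span (Set.range Fs)))).presheaf.stalk x) p (e x).symm
      (fiClause_atPrime_of_exists_not_mem p hp k n r Fs hprime hoff x.asIdeal (hne x.asIdeal x.2 hx)).2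
  refine OfPointFixable.fInjectiveMacaulayfication_of_pointFixable p hp k (Spec (.of (MvPolynomial (Fin n) k ⧸ Ideal.span (Set.range Fs)))) f₁ hsep hft hqc
    hint ?_ ?_ ?_
  · -- every stalk is Cohen–Macaulay
    intro x
    by_cases hx : x.asIdeal = Ideal.span (Set.range fun j : Fin n => Ideal.Quotient.mk (Ideal.span (Set.range Fs)) (X j))
    · haveI : x.asIdeal.IsMaximal := hx ▸ h𝔪
      exact FiLocusOpenOfAffine.cmClause_of_ringEquiv (A := Localization.AtPrime x.asIdeal)
        (B := (Spec (.of (MvPolynomial (Fin n) k ⧸ Ideal.span (Set.range Fs)))).presheaf.stalk x) (e x).symm (hCM x.asIdeal)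
    · exact fun d hd s hs => (hfull x hx d hd s hs).1
  · -- the non-F-injective locus is inside the origin
    refine (Set.finite_singleton (⟨Ideal.span (Set.range fun j : Fin n => Ideal.Quotient.mk (Ideal.span (Set.range Fs)) (X j)), h𝔪.isPrime⟩ : Spec (.of (MvPolynomial (Fin n) k ⧸ Ideal.span (Set.range Fs))))).subset fun x hx => ?_
    refine Set.mem_singleton_iff.mpr ?_
    by_contra hxne
    have hx' : x.asIdeal ≠ Ideal.span (Set.range fun j : Fin n => Ideal.Quotient.mk (Ideal.span (Set.range Fs)) (X j)) := fun h => hxne (PrimeSpectrum.ext h)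
    exact hx fun d hd s hs => (hfull x hx' d hd s hs).2
  · -- point-fixability at the (only possible) bad point
    intro b hb
    apply h0 b
    by_contra hb'
    exact hb fun d hd s hs => (hfull b hb' d hd s hs).2

end Summit.ResolutionOfSingularities.ResolutionOfSingularities.Theorems.FInjectiveMacaulayfication.SpecimenDoor
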